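import Summits.BirchSwinnertonDyer.Rank1Residual.Additive.RankOneUpperHalfUnitRows
import Summits.BirchSwinnertonDyer.Rank1Residual.Additive.CensusX42Bridges
import Summits.BirchSwinnertonDyer.Rank1Residual.Additive.CongruentPartnerBranchPAdicGrossZagierIff
import HarnessLib

/-!
# Census records, rank one, UNIT rows of `Ш_an`: the census relation X4-2 AT THE PAIR + the
# hna-free UPPER half ⟹ `BSD(E,p)` — NO certificate, NO Λ-adic LOWER, NO budget, EVERY odd `p`
# (cell `b2b-bsdres`, census cell `bsd-formula-census`, seat `b2b-bsdres-census-ctyper1` =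
# conjecture-typer 1, gen 6; "(S10) × X4-2": team n1011 seat p16's `RankOneUpperHalfUnitRows.lean`
# (p262041, route planner 3's sub-target (S10)) composed with this seat's bridges
# `CensusX42Bridges.lean` / `CensusX42Bridge.lean`; route planner 3's note ROUTE-3.md l.67)

HONEST FRAMING (cell `b2b-bsdres`, run/shared/lean/b2b/bsd-rank1-residual/, verbatim in every
file): the goal of the cell is to DELETE the COMBINATION-SHAPED residual classes of the
Birch–Swinnerton-Dyer formula for ALL analytic-rank `≤ 1` elliptic curves over `ℚ` — "full BSD
formula for every rank `≤ 1` curve in class `C`" assembled STRICTLY from published theorems — so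
that the rank-`≤ 1` remainder becomes exactly the CONSTRUCTION-SHAPED classes, which are TYPED
(missing-input `Prop`s), NOT attempted. This is not "finishing BSD". Census cell
(bsd-formula-census): research instrumentation; census output = EVIDENCE / conjecture items, never a
Literature fact; labels / RESIDUAL-MAP marks UNCHANGED (O7-ord OPEN; X3♯ / X4♯ CONSTRUCTION-SHAPED);
nothing booked. THEOREMS ONLY (no definition, no named fact); named facts enter as HYPOTHESES
(Kato 2004 Thm. 17.4 (3) `hK`, Wuthrich 2014 Thm. 16 `hWu` / `hW16`, Delbourgo 2002 `hDel` /
`hDel3` / `hDelM`, Gross–Zagier I.(7.3) `hGZ`, GZK `hGZK`, modularity `hmod` / `hmodD`); the census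
relation `CensusX42.RelationAt W p Dh` (`Additive/CensusX42LeadingTerm.lean`, `@[conjecture]`,
label CANDIDATE — EVIDENCE, X42-REPORT.md sha256
`e8592c9a2e1a59c13e754928288c9f6b1ce554f7ffb80b93db3c55aa7f5e9950`) is a HYPOTHESIS at the pair
(resp. for every (B)-datum); the analytic order of `Ш` enters as a census LITERAL per row
(`hs : shaAn W = s`, `hsv : ord_p s = 0`, EVIDENCE when instantiated).

## What

Seat p16 proved ((S10), `RankOneUpperHalfUnitRows.lean`): on an additive potentially semistable
rank-ONE row the cell's UPPER halves `ord_p #Ш ≤ ord_p #Ш_an` (Kato's half-eigen reading on X4♯(G-ord)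
∩ {`ρ̄` onto} and X4(M) ∩ {`ρ̄` onto}; Wuthrich's Thm. 16 half on X3♯(G-ord) / X3♯(M), no image
hypothesis) need NO anomalous proviso, NO unit-coefficient certificate and NO Λ-adic LOWER; with
`p ∤ #Ш_an(E)` the one-sided bound pinches `0 ≤ ord_p #Ш ≤ ord_p #Ш_an = 0`, i.e. `BSD(E,p)`. Its only
non-fact inputs are the Schneider rider `hS : SchneiderConjecture Dh` and the typed branch `p`-adic
Gross–Zagier `BranchPAdicGrossZagier[∅|Odd|Mult]At W p Dh` for a Delbourgo (B)-datum `Dh`. This seat's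
bridges read BOTH off the census relation at the pair: `CensusX42.schneider_of_relationAt[_mult]`,
`CensusX42.branchPAdicGrossZagierAt_of_relationAt` (gen 2, even branch),
`CensusX42.branchPAdicGrossZagierOddAt_of_relationAt`, `CensusX42.branchPAdicGrossZagierMultAt_of_relationAt`
(gen 4). Hence, parity-uniformly in the odd prime `p`:

* §1 (one datum) **`CensusX42.RelationAt W p Dh` for a (B)-datum `Dh` + the published half + `p ∤ #Ш_an`
  ⟹ `BSD(E,p)`** — `ClassX4Gord.bsdp_rankOne_of_katoHalf_of_censusX42_of_shaAn_unit` (X4♯(G-ord, `e = 2`)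
  ∩ {`ρ̄` onto}, every odd `p`; `p = 3` form `…three…` with `e = 2` automatic),
  `ClassX3Gord.bsdp_rankOne_of_wuthrichHalf_of_censusX42_of_shaAn_unit` (+ `…three…`),
  `ClassX4M.bsdp_rankOne_of_katoHalf_of_censusX42_of_shaAn_unit`,
  `ClassX3M.bsdp_rankOne_of_wuthrichHalf_of_censusX42_of_shaAn_unit`;
* §2 (`∀ Dh`, Delbourgo 2002 (A)+(B) SUPPLYING the (B)-datum) **the census relation for every (B)-datum
  + Delbourgo 2002 + the published half + `p ∤ #Ш_an` ⟹ `BSD(E,p)`** —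
  `ClassX4Gord.bsdp_rankOne_of_katoHalf_of_delbourgo_of_forall_censusX42_of_shaAn_unit` (`p ≥ 5`, non-CM
  AUTOMATIC from `ρ̄` onto by p01's `ClassX4Gord.not_hasCM_of_surj_of_five_le`), `…three…` (`hDel3`,
  `hcm`), the X3♯(G-ord) twins (`hcm` explicit), `ClassX4M.…` / `ClassX3M.…` (`hDelM`, every odd `p`);
* §3 the form for THE census height (gen 2's `RelationAtCensusHeight W p`, scope `p ≥ 5`,
  `j(E) ∉ {0, 1728}`): `ClassX4Gord.bsdp_rankOne_of_katoHalf_of_censusX42Height_of_shaAn_unit`.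

Compared with gen 3's CERT-version unit-row nodes `ClassX4Gord.bsdp_of_censusX42_of_katoHalf_of_cert_of_shaAn_unit`
(`CensusX42BSD.lean`, binders `hp5 : 5 ≤ p` and `hcert : BranchUnitCertificateAt W p`) and its X3♯ twin
(`CensusX42BSDCorollaries.lean`): the certificate binder, the `5 ≤ p` binder and the parity split are GONE
— route planner 3's remark of record (cells/n1011/ROUTE-3.md l.67, 2026-08-21T10:00Z: "the (S10)-shaped
census twin at p = 3 … is NOT in the tree … for census-ctyper1 / the dealer to place IF (S10) is dealt";
(S10) was dealt and landed as p262041).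

EVIDENCE READING (never a fact; nothing asserted about any curve). The unit literal `ord_p #Ш_an = 0` is
the census's own column on EVERY X4-2 row of record: `#Ш_an = 1` on all 700 rank-one pairs `N ≤ 3000`
(X42-REPORT.md, sha above; (M) 558 + Gord2 141 fitted + 1 set aside) and on all 429 WINDOW pairs
`N < 2·10⁴` (X42-WINDOW.md sha256 `a10a170979128fde17cf31b1704581a6d978f587434da820ed86243fc49ef835`,
table x42/window/X42_window_valuations.tsv sha256
`3a31299352f404150bc3121f576e01cc680e3a1caf74ee5a2edd6424fc01e7b5`: cells M 287 / Gord3 128 / Gord_e2 14,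
`p = 3`: 397, `p = 5`: 32; per-pair valuation certificates `v_p(A′) = v_p(h) + v_p(#Ш_an·∏c/#T²)` on
429/429 with `v_p(A′) ∈ {1: 315, 2: 79, 3: 24, 4: 8, 5: 2, 7: 1}` — label EVIDENCE, Engine C review
ACCEPT 2026-08-21T10:37Z). So on every X4-2 row of record — INCLUDING the 114 window rows with
`v_p(A′) ≥ 2` (first unit index `≥ 2`, where neither gen 3's index-1 certificate nor a free budget is
available) — the CANDIDATE relation at the pair for a (B)-datum, the published half (Kato on `ρ̄`-onto
X4 rows, Wuthrich on X3♯ rows), Gross–Zagier I.(7.3), GZK and modularity give `BSD(E,p)` by the §1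
theorem of its class; EVIDENCE-conditional on the relation, exactly as typed. Nothing booked.

References: K. Kato, Astérisque 295 (2004) Thm. 17.4 (3) [Kato2004Asterisque]; C. Wuthrich, Doc. Math.
19 (2014) Thm. 16 [Wuthrich2014]; D. Delbourgo, J. Number Theory 95 (2002) Thm. (A)/(B)
[Delbourgo2002]; B. Gross, D. Zagier, Invent. Math. 84 (1986) Thm. I.(7.3) [GrossZagier1986];
B. Mazur, J. Tate, J. Teitelbaum, Invent. Math. 84 (1986) §I.10, §I.13 [MazurTateTeitelbaum1986Invent];
P. Schneider, Invent. Math. 69 (1982) §1 [Schneider1982PadicHeightI]; B. Mazur, W. Stein, J. Tate,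
Doc. Math. Extra Vol. Coates (2006) Thm. 1.3 [MazurSteinTate2006]; R. L. Miller, LMS J. Comput. Math.
14 (2011) Def. 1.1 [Miller2011LMS]; census files of record (module docstring of `CensusX42LeadingTerm.lean`).
-/

set_option autoImplicit false

noncomputable section

open scoped Classical MatrixGroups ModularForm NumberField

open CongruenceSubgroup WeierstrassCurve NumberField Literature.NumberTheory.EllipticCurves
  Literature.NumberTheory.EllipticCurves.ModularForms
  Literature.NumberTheory.EllipticCurves.Rank1Residual
  Literature.NumberTheory.EllipticCurves.Rank1Residual.Typed
  Literature.NumberTheory.EllipticCurves.Delbourgo2002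
  Literature.NumberTheory.GaloisRepresentations
  Summit.BirchSwinnertonDyer.Rank1Residual.AdditivePotMult

namespace Summit.BirchSwinnertonDyer.Rank1Residual.Additive

open CensusX42

variable {W : WeierstrassCurve ℚ} [W.IsElliptic] [W.IsGloballyMinimal] {p : ℕ} [hp : Fact p.Prime]

omit [W.IsElliptic] [W.IsGloballyMinimal] in
/-- An odd prime is `≡ 1` or `≡ 3 (mod 4)` (parity bookkeeping for the branch index `(p−1)/2`). -/
private theorem mod_four_eq_one_or_three (hp2 : p ≠ 2) : p % 4 = 1 ∨ p % 4 = 3 := by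
  obtain ⟨k, hk⟩ := hp.out.odd_of_ne_two hp2
  omega

/-! ### §1 One (B)-datum: the census relation AT THE PAIR + the published half + `p ∤ #Ш_an` ⟹ `BSD(E,p)` -/

/-- **X4♯(G-ord, `e = 2`) ∩ {`ρ̄_{E,p}` onto}, `r_an = 1`, EVERY odd `p` (incl. `3`), `p ∤ #Ш_an(E)`:**
Kato's half-eigen reading (`hK`) + a Delbourgo (B)-datum `Dh` (`hB`) + **the census relation X4-2 at the
pair for `Dh`** (`hrel`, CANDIDATE — it supplies the Schneider rider and the typed branch `p`-adic
Gross–Zagier of the row by `schneider_of_relationAt` / `branchPAdicGrossZagier[Odd]At_of_relationAt`) +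
GZ I.(7.3) + GZK + modularity + the unit literal (`hs`, `hsv`) ⟹ `BSD(E,p)`, by seat p16's hna-free UPPER
half `…_of_shaAn_unit` on the branch of the parity of `(p−1)/2`. NO certificate, NO LOWER, NO budget, NO
anomalous proviso, NO `5 ≤ p`. [cite: Kato2004Asterisque, Thm. 17.4 (3) (p. 273)]
[cite: Delbourgo2002, Theorem (B) (p. 40)] [cite: GrossZagier1986, Thm. I.(7.3)]
[cite: MazurTateTeitelbaum1986Invent, §I.13] [cite: Miller2011LMS, Def. 1.1] -/
theorem ClassX4Gord.bsdp_rankOne_of_katoHalf_of_censusX42_of_shaAn_unit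
    (hK : Wuthrich2014.kato_halfEigenCharIdeal_dvd_cyclotomicPrime_of_surjective)
    (hGZ : GrossZagier1986_thm_I_7_3) (hGZK : rank_eq_analyticRank_of_analyticRank_le_one)
    (hmod : hasEntireLFunction_rat) (hmodD : nonempty_modularParametrizationData)
    (hX : ClassX4Gord W p) (he : semistabilityIndex W p = 2) (hsurj : Surj W p)
    (hr : W.analyticRank = 1) {Dh : PAdicHeightData W p} (hB : LeadingTermClauses W p Dh)
    (hrel : RelationAt W p Dh) {s : ℚ} (hs : shaAn W = (s : ℂ)) (hsv : padicValRat p s = 0) :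
    BSDp W p := by
  have hp2 : p ≠ 2 := hX.addv.1
  have hS : SchneiderConjecture Dh :=
    schneider_of_relationAt hGZ hGZK hmodD hp2 hX.typeGOrd hX.addv.2 he hr hrel
  rcases mod_four_eq_one_or_three (p := p) hp2 with h1 | h3
  · exact hX.bsdp_rankOne_of_katoHalf_of_schneider_of_branchPAdicGrossZagier_of_shaAn_unit hK hGZK hmod
      hmodD he h1 hsurj hr hB hS (branchPAdicGrossZagierAt_of_relationAt p hGZ hGZK W hX.addv.2 hr Dh hrel)
      hs hsv
  · exact hX.bsdp_rankOne_of_katoHalf_of_branchPAdicGrossZagierOdd_of_shaAn_unit hK hGZK hmod hmodD he h3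
      hsurj hr hB hS (branchPAdicGrossZagierOddAt_of_relationAt hGZ hGZK W hp2 hX.addv.2 hr Dh hrel) hs hsv

/-- **At `p = 3`** (`e = 2` automatic for type (G) at `3`): X4♯(G-ord)@3 ∩ {`ρ̄_{E,3}` onto}, `r_an = 1`,
`3 ∤ #Ш_an(E)`, the census relation at the pair for a (B)-datum ⟹ `BSD(E,3)` (the (G-ord) WINDOW rows
at `3` are the 128 `Gord3` pairs of X42-WINDOW.md, all `#Ш_an = 1`; the `N ≤ 3000` Gord2 rows at `3`: 94).
[cite: Kato2004Asterisque, Thm. 17.4 (3) (p. 273)] [cite: Delbourgo2002, Theorem (B) (p. 40)]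
[cite: GrossZagier1986, Thm. I.(7.3)] [cite: Miller2011LMS, Def. 1.1] -/
theorem ClassX4Gord.bsdp_three_rankOne_of_katoHalf_of_censusX42_of_shaAn_unit
    [Fact (Nat.Prime 3)] {W : WeierstrassCurve ℚ} [W.IsElliptic] [W.IsGloballyMinimal]
    (hK : Wuthrich2014.kato_halfEigenCharIdeal_dvd_cyclotomicPrime_of_surjective)
    (hGZ : GrossZagier1986_thm_I_7_3) (hGZK : rank_eq_analyticRank_of_analyticRank_le_one)
    (hmod : hasEntireLFunction_rat) (hmodD : nonempty_modularParametrizationData)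
    (hX : ClassX4Gord W 3) (hsurj : Surj W 3) (hr : W.analyticRank = 1) {Dh : PAdicHeightData W 3}
    (hB : LeadingTermClauses W 3 Dh) (hrel : RelationAt W 3 Dh) {s : ℚ} (hs : shaAn W = (s : ℂ))
    (hsv : padicValRat 3 s = 0) : BSDp W 3 :=
  hX.bsdp_rankOne_of_katoHalf_of_censusX42_of_shaAn_unit hK hGZ hGZK hmod hmodD
    (semistabilityIndex_eq_two_of_typeG_three W hX.typeGOrd.typeG hX.addv.2) hsurj hr hB hrel hs hsv

/-- **X3♯(G-ord, `e = 2`) (reducible `E[p]` allowed — NO image hypothesis), `r_an = 1`, EVERY odd `p`,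
`p ∤ #Ш_an(E)`:** Wuthrich's Thm. 16 integral half (`hWu`) + a (B)-datum + **the census relation at the
pair** + GZ + GZK + modularity + the unit literal ⟹ `BSD(E,p)` (seat p12's X3♯ UPPER half inside p16's
(S10) form; rider and typed GZ read off the relation). [cite: Wuthrich2014, Thm. 16 (p. 397)]
[cite: Delbourgo2002, Theorem (B) (p. 40)] [cite: GrossZagier1986, Thm. I.(7.3)] [cite: Miller2011LMS, Def. 1.1] -/
theorem ClassX3Gord.bsdp_rankOne_of_wuthrichHalf_of_censusX42_of_shaAn_unit
    (hWu : Wuthrich2014.thm16_halfEigenCharIdeal_dvd_cyclotomicPrime)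
    (hGZ : GrossZagier1986_thm_I_7_3) (hGZK : rank_eq_analyticRank_of_analyticRank_le_one)
    (hmod : hasEntireLFunction_rat) (hmodD : nonempty_modularParametrizationData)
    (hX : ClassX3Gord W p) (hp2 : p ≠ 2) (he : semistabilityIndex W p = 2) (hr : W.analyticRank = 1)
    {Dh : PAdicHeightData W p} (hB : LeadingTermClauses W p Dh) (hrel : RelationAt W p Dh)
    {s : ℚ} (hs : shaAn W = (s : ℂ)) (hsv : padicValRat p s = 0) : BSDp W p := by
  have hS : SchneiderConjecture Dh :=
    schneider_of_relationAt hGZ hGZK hmodD hp2 hX.typeGOrd hX.addv he hr hrel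
  rcases mod_four_eq_one_or_three (p := p) hp2 with h1 | h3
  · exact hX.bsdp_rankOne_of_wuthrichHalf_of_schneider_of_branchPAdicGrossZagier_of_shaAn_unit hWu hGZK
      hmod hmodD he h1 hr hB hS (branchPAdicGrossZagierAt_of_relationAt p hGZ hGZK W hX.addv hr Dh hrel)
      hs hsv
  · exact hX.bsdp_rankOne_of_wuthrichHalf_of_branchPAdicGrossZagierOdd_of_shaAn_unit hWu hGZK hmod hmodD
      he h3 hr hB hS (branchPAdicGrossZagierOddAt_of_relationAt hGZ hGZK W hp2 hX.addv hr Dh hrel) hs hsv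

/-- **At `p = 3`**: X3♯(G-ord)@3, `r_an = 1`, `3 ∤ #Ш_an(E)`, the census relation at the pair for a
(B)-datum ⟹ `BSD(E,3)` from Wuthrich's half (no image hypothesis; `e = 2` automatic).
[cite: Wuthrich2014, Thm. 16 (p. 397)] [cite: GrossZagier1986, Thm. I.(7.3)] [cite: Miller2011LMS, Def. 1.1] -/
theorem ClassX3Gord.bsdp_three_rankOne_of_wuthrichHalf_of_censusX42_of_shaAn_unit
    [Fact (Nat.Prime 3)] {W : WeierstrassCurve ℚ} [W.IsElliptic] [W.IsGloballyMinimal]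
    (hWu : Wuthrich2014.thm16_halfEigenCharIdeal_dvd_cyclotomicPrime)
    (hGZ : GrossZagier1986_thm_I_7_3) (hGZK : rank_eq_analyticRank_of_analyticRank_le_one)
    (hmod : hasEntireLFunction_rat) (hmodD : nonempty_modularParametrizationData)
    (hX : ClassX3Gord W 3) (hr : W.analyticRank = 1) {Dh : PAdicHeightData W 3}
    (hB : LeadingTermClauses W 3 Dh) (hrel : RelationAt W 3 Dh) {s : ℚ} (hs : shaAn W = (s : ℂ))
    (hsv : padicValRat 3 s = 0) : BSDp W 3 :=
  hX.bsdp_rankOne_of_wuthrichHalf_of_censusX42_of_shaAn_unit hWu hGZ hGZK hmod hmodD (by norm_num)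
    (semistabilityIndex_eq_two_of_typeG_three W hX.typeGOrd.typeG hX.addv) hr hB hrel hs hsv

end Summit.BirchSwinnertonDyer.Rank1Residual.Additive

namespace Summit.BirchSwinnertonDyer.Rank1Residual.AdditivePotMult

open Additive CensusX42

variable {W : WeierstrassCurve ℚ} [W.IsElliptic] [W.IsGloballyMinimal] {p : ℕ} [hp : Fact p.Prime]

/-- **X4(M) ∩ {`ρ̄_{E,p}` onto}, `r_an = 1`, EVERY odd `p` (incl. `3`), `p ∤ #Ш_an(E)`:** Kato's half
(`hK`) + a (B)-datum + **the census relation at the pair** (rider by `schneider_of_relationAt_mult`,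
typed (M)-branch GZ by `branchPAdicGrossZagierMultAt_of_relationAt`, both parities, `ã = a_p(E♭) = ±1`) +
GZ + GZK + modularity + the unit literal ⟹ `BSD(E,p)`. The (M) WINDOW rows at `3` are 287 pairs, the
`N ≤ 3000` (M) rows 558, all `#Ш_an = 1`. [cite: Kato2004Asterisque, Thm. 17.4 (3) (p. 273)]
[cite: Delbourgo2002, Theorem (B) (p. 40)] [cite: GrossZagier1986, Thm. I.(7.3)]
[cite: MazurTateTeitelbaum1986Invent, §I.10, §I.13] [cite: Miller2011LMS, Def. 1.1] -/
theorem ClassX4M.bsdp_rankOne_of_katoHalf_of_censusX42_of_shaAn_unit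
    (hK : Wuthrich2014.kato_halfEigenCharIdeal_dvd_cyclotomicPrime_of_surjective)
    (hGZ : GrossZagier1986_thm_I_7_3) (hGZK : rank_eq_analyticRank_of_analyticRank_le_one)
    (hmod : hasEntireLFunction_rat) (hmodD : nonempty_modularParametrizationData)
    (hX : ClassX4M W p) (hsurj : Surj W p) (hr : W.analyticRank = 1) {Dh : PAdicHeightData W p}
    (hB : LeadingTermClauses W p Dh) (hrel : RelationAt W p Dh) {s : ℚ} (hs : shaAn W = (s : ℂ))
    (hsv : padicValRat p s = 0) : BSDp W p :=
  hX.bsdp_rankOne_of_katoHalf_of_branchPAdicGrossZagierMult_of_shaAn_unit hK hGZK hmod hmodD hsurj hr hB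
    (schneider_of_relationAt_mult hGZ hGZK hmodD hX.p_ne_two (ClassX4M.potMult W p hX) hr hrel)
    (branchPAdicGrossZagierMultAt_of_relationAt hGZ hGZK W hX.classX4.2.1 hr Dh hrel) hs hsv

/-- **X3♯(M) (reducible `E[p]`; NO image / tower / CM / anomalous binder), `r_an = 1`, EVERY odd `p`,
`p ∤ #Ш_an(E)`:** Wuthrich's Thm. 16 half (`hW16`) + a (B)-datum + **the census relation at the pair** +
GZ + GZK + modularity + the unit literal ⟹ `BSD(E,p)`. [cite: Wuthrich2014, Thm. 16 (p. 397)]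
[cite: Delbourgo2002, Theorem (B) (p. 40)] [cite: GrossZagier1986, Thm. I.(7.3)] [cite: Miller2011LMS, Def. 1.1] -/
theorem ClassX3M.bsdp_rankOne_of_wuthrichHalf_of_censusX42_of_shaAn_unit
    (hW16 : Wuthrich2014.thm16_halfEigenCharIdeal_dvd_cyclotomicPrime)
    (hGZ : GrossZagier1986_thm_I_7_3) (hGZK : rank_eq_analyticRank_of_analyticRank_le_one)
    (hmod : hasEntireLFunction_rat) (hmodD : nonempty_modularParametrizationData)
    (hX : ClassX3M W p) (hr : W.analyticRank = 1) {Dh : PAdicHeightData W p}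
    (hB : LeadingTermClauses W p Dh) (hrel : RelationAt W p Dh) {s : ℚ} (hs : shaAn W = (s : ℂ))
    (hsv : padicValRat p s = 0) : BSDp W p :=
  hX.bsdp_rankOne_of_wuthrichHalf_of_branchPAdicGrossZagierMult_of_shaAn_unit hW16 hGZK hmod hmodD hr hB
    (schneider_of_relationAt_mult hGZ hGZK hmodD hX.p_ne_two hX.potMult hr hrel)
    (branchPAdicGrossZagierMultAt_of_relationAt hGZ hGZK W hX.potMult.1 hr Dh hrel) hs hsv

end Summit.BirchSwinnertonDyer.Rank1Residual.AdditivePotMult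

namespace Summit.BirchSwinnertonDyer.Rank1Residual.Additive

open CensusX42

variable {W : WeierstrassCurve ℚ} [W.IsElliptic] [W.IsGloballyMinimal] {p : ℕ} [hp : Fact p.Prime]

/-! ### §2 `∀ Dh` forms: Delbourgo 2002 (A)+(B) SUPPLIES the (B)-datum; the census relation for every (B)-datum -/

/-- **X4♯(G-ord, `e = 2`) ∩ {`ρ̄` onto}, `p ≥ 5`, `r_an = 1`, `p ∤ #Ш_an(E)`:** Delbourgo 2002 (A)+(B)
(`hDel`; non-CM AUTOMATIC from `ρ̄_{E,p}` onto at `p ≥ 5`, p01's `ClassX4Gord.not_hasCM_of_surj_of_five_le`)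
+ Kato's half + **the census relation for every (B)-datum** + GZ + GZK + modularity + the unit literal
⟹ `BSD(E,p)`. [cite: Delbourgo2002, Theorem (A), (B) (p. 40)] [cite: Kato2004Asterisque, Thm. 17.4 (3) (p. 273)]
[cite: GrossZagier1986, Thm. I.(7.3)] [cite: Miller2011LMS, Def. 1.1] -/
theorem ClassX4Gord.bsdp_rankOne_of_katoHalf_of_delbourgo_of_forall_censusX42_of_shaAn_unit
    (hDel : Delbourgo2002.mainTheorem)
    (hK : Wuthrich2014.kato_halfEigenCharIdeal_dvd_cyclotomicPrime_of_surjective)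
    (hGZ : GrossZagier1986_thm_I_7_3) (hGZK : rank_eq_analyticRank_of_analyticRank_le_one)
    (hmod : hasEntireLFunction_rat) (hmodD : nonempty_modularParametrizationData)
    (hX : ClassX4Gord W p) (he : semistabilityIndex W p = 2) (hp5 : 5 ≤ p) (hsurj : Surj W p)
    (hr : W.analyticRank = 1)
    (hrel : ∀ Dh : PAdicHeightData W p, LeadingTermClauses W p Dh → RelationAt W p Dh)
    {s : ℚ} (hs : shaAn W = (s : ℂ)) (hsv : padicValRat p s = 0) : BSDp W p := by
  obtain ⟨Dh, hB⟩ := hDel.exists_leadingTermClauses hp5 (hX.not_hasCM_of_surj_of_five_le he hp5 hsurj)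
    hX.1.2.1 hX.2
  exact hX.bsdp_rankOne_of_katoHalf_of_censusX42_of_shaAn_unit hK hGZ hGZK hmod hmodD he hsurj hr hB
    (hrel Dh hB) hs hsv

/-- **At `p = 3`** on X4♯(G-ord) WITH Delbourgo 2002 (A)+(B) at `3` supplying the (B)-datum (`hDel3`,
non-CM binder `hcm` explicit; bridge `ClassX4Gord.delbourgo2002_three`): X4♯(G-ord)@3 ∩ {`ρ̄_{E,3}` onto},
`r_an = 1`, `3 ∤ #Ш_an(E)`, the census relation for every (B)-datum ⟹ `BSD(E,3)`.
[cite: Delbourgo2002, Theorem (A), (B), Example (p. 40)] [cite: Kato2004Asterisque, Thm. 17.4 (3) (p. 273)]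
[cite: GrossZagier1986, Thm. I.(7.3)] [cite: Miller2011LMS, Def. 1.1] -/
theorem ClassX4Gord.bsdp_three_rankOne_of_katoHalf_of_delbourgo_of_forall_censusX42_of_shaAn_unit
    [Fact (Nat.Prime 3)] {W : WeierstrassCurve ℚ} [W.IsElliptic] [W.IsGloballyMinimal]
    (hDel3 : Delbourgo2002.mainTheorem_three)
    (hK : Wuthrich2014.kato_halfEigenCharIdeal_dvd_cyclotomicPrime_of_surjective)
    (hGZ : GrossZagier1986_thm_I_7_3) (hGZK : rank_eq_analyticRank_of_analyticRank_le_one)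
    (hmod : hasEntireLFunction_rat) (hmodD : nonempty_modularParametrizationData)
    (hX : ClassX4Gord W 3) (hcm : ¬ W.HasCM) (hsurj : Surj W 3) (hr : W.analyticRank = 1)
    (hrel : ∀ Dh : PAdicHeightData W 3, LeadingTermClauses W 3 Dh → RelationAt W 3 Dh)
    {s : ℚ} (hs : shaAn W = (s : ℂ)) (hsv : padicValRat 3 s = 0) : BSDp W 3 := by
  obtain ⟨-, Dh, hB⟩ := hX.delbourgo2002_three hDel3 hcm
  exact hX.bsdp_three_rankOne_of_katoHalf_of_censusX42_of_shaAn_unit hK hGZ hGZK hmod hmodD hsurj hr hB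
    (hrel Dh hB) hs hsv

/-- **X3♯(G-ord, `e = 2`), `p ≥ 5`, non-CM, `r_an = 1`, `p ∤ #Ш_an(E)`:** Delbourgo 2002 (A)+(B) (`hDel`,
`hcm` explicit — no image hypothesis to discharge it) + Wuthrich's half + **the census relation for every
(B)-datum** + GZ + GZK + modularity + the unit literal ⟹ `BSD(E,p)`.
[cite: Delbourgo2002, Theorem (A), (B) (p. 40)] [cite: Wuthrich2014, Thm. 16 (p. 397)]
[cite: GrossZagier1986, Thm. I.(7.3)] [cite: Miller2011LMS, Def. 1.1] -/
theorem ClassX3Gord.bsdp_rankOne_of_wuthrichHalf_of_delbourgo_of_forall_censusX42_of_shaAn_unit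
    (hDel : Delbourgo2002.mainTheorem) (hWu : Wuthrich2014.thm16_halfEigenCharIdeal_dvd_cyclotomicPrime)
    (hGZ : GrossZagier1986_thm_I_7_3) (hGZK : rank_eq_analyticRank_of_analyticRank_le_one)
    (hmod : hasEntireLFunction_rat) (hmodD : nonempty_modularParametrizationData)
    (hX : ClassX3Gord W p) (he : semistabilityIndex W p = 2) (hp5 : 5 ≤ p) (hcm : ¬ W.HasCM)
    (hr : W.analyticRank = 1)
    (hrel : ∀ Dh : PAdicHeightData W p, LeadingTermClauses W p Dh → RelationAt W p Dh)
    {s : ℚ} (hs : shaAn W = (s : ℂ)) (hsv : padicValRat p s = 0) : BSDp W p := by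
  obtain ⟨Dh, hB⟩ := hDel.exists_leadingTermClauses hp5 hcm hX.1.2 hX.2
  exact hX.bsdp_rankOne_of_wuthrichHalf_of_censusX42_of_shaAn_unit hWu hGZ hGZK hmod hmodD (by omega) he
    hr hB (hrel Dh hB) hs hsv

/-- **At `p = 3`** on X3♯(G-ord) WITH Delbourgo 2002 at `3` supplying the (B)-datum (`hDel3`, `hcm`;
bridge `ClassX3Gord.delbourgo2002_three`; NO image hypothesis): `r_an = 1`, `3 ∤ #Ш_an(E)`, the census
relation for every (B)-datum ⟹ `BSD(E,3)`. [cite: Delbourgo2002, Theorem (A), (B), Example (p. 40)]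
[cite: Wuthrich2014, Thm. 16 (p. 397)] [cite: GrossZagier1986, Thm. I.(7.3)] [cite: Miller2011LMS, Def. 1.1] -/
theorem ClassX3Gord.bsdp_three_rankOne_of_wuthrichHalf_of_delbourgo_of_forall_censusX42_of_shaAn_unit
    [Fact (Nat.Prime 3)] {W : WeierstrassCurve ℚ} [W.IsElliptic] [W.IsGloballyMinimal]
    (hDel3 : Delbourgo2002.mainTheorem_three)
    (hWu : Wuthrich2014.thm16_halfEigenCharIdeal_dvd_cyclotomicPrime)
    (hGZ : GrossZagier1986_thm_I_7_3) (hGZK : rank_eq_analyticRank_of_analyticRank_le_one)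
    (hmod : hasEntireLFunction_rat) (hmodD : nonempty_modularParametrizationData)
    (hX : ClassX3Gord W 3) (hcm : ¬ W.HasCM) (hr : W.analyticRank = 1)
    (hrel : ∀ Dh : PAdicHeightData W 3, LeadingTermClauses W 3 Dh → RelationAt W 3 Dh)
    {s : ℚ} (hs : shaAn W = (s : ℂ)) (hsv : padicValRat 3 s = 0) : BSDp W 3 := by
  obtain ⟨-, Dh, hB⟩ := hX.delbourgo2002_three hDel3 hcm
  exact hX.bsdp_three_rankOne_of_wuthrichHalf_of_censusX42_of_shaAn_unit hWu hGZ hGZK hmod hmodD hr hB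
    (hrel Dh hB) hs hsv

end Summit.BirchSwinnertonDyer.Rank1Residual.Additive

namespace Summit.BirchSwinnertonDyer.Rank1Residual.AdditivePotMult

open Additive CensusX42

variable {W : WeierstrassCurve ℚ} [W.IsElliptic] [W.IsGloballyMinimal] {p : ℕ} [hp : Fact p.Prime]

/-- **X4(M) ∩ {`ρ̄` onto}, EVERY odd `p` (incl. `3`), `r_an = 1`, `p ∤ #Ш_an(E)`:** Delbourgo 2002 (M)
(`hDelM`, every hypothesis discharged on (M) by `ClassX4M.delbourgo2002`; no CM binder) + Kato's half +
**the census relation for every (B)-datum** + GZ + GZK + modularity + the unit literal ⟹ `BSD(E,p)`.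
[cite: Delbourgo2002, Theorem (A), (B), Example (p. 40)] [cite: Kato2004Asterisque, Thm. 17.4 (3) (p. 273)]
[cite: GrossZagier1986, Thm. I.(7.3)] [cite: Miller2011LMS, Def. 1.1] -/
theorem ClassX4M.bsdp_rankOne_of_katoHalf_of_delbourgo_of_forall_censusX42_of_shaAn_unit
    (hDelM : Delbourgo2002.mainTheorem_potMult)
    (hK : Wuthrich2014.kato_halfEigenCharIdeal_dvd_cyclotomicPrime_of_surjective)
    (hGZ : GrossZagier1986_thm_I_7_3) (hGZK : rank_eq_analyticRank_of_analyticRank_le_one)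
    (hmod : hasEntireLFunction_rat) (hmodD : nonempty_modularParametrizationData)
    (hX : ClassX4M W p) (hsurj : Surj W p) (hr : W.analyticRank = 1)
    (hrel : ∀ Dh : PAdicHeightData W p, LeadingTermClauses W p Dh → RelationAt W p Dh)
    {s : ℚ} (hs : shaAn W = (s : ℂ)) (hsv : padicValRat p s = 0) : BSDp W p := by
  obtain ⟨-, Dh, hB⟩ := hX.delbourgo2002 hDelM
  exact hX.bsdp_rankOne_of_katoHalf_of_censusX42_of_shaAn_unit hK hGZ hGZK hmod hmodD hsurj hr hB
    (hrel Dh hB) hs hsv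

/-- **X3♯(M), EVERY odd `p`, `r_an = 1`, `p ∤ #Ш_an(E)`** (NO image / tower / CM / anomalous binder):
Delbourgo 2002 (M) (`hDelM`, bridge `ClassX3M.delbourgo2002`) + Wuthrich's half + **the census relation
for every (B)-datum** + GZ + GZK + modularity + the unit literal ⟹ `BSD(E,p)`.
[cite: Delbourgo2002, Theorem (A), (B), Example (p. 40)] [cite: Wuthrich2014, Thm. 16 (p. 397)]
[cite: GrossZagier1986, Thm. I.(7.3)] [cite: Miller2011LMS, Def. 1.1] -/
theorem ClassX3M.bsdp_rankOne_of_wuthrichHalf_of_delbourgo_of_forall_censusX42_of_shaAn_unit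
    (hDelM : Delbourgo2002.mainTheorem_potMult)
    (hW16 : Wuthrich2014.thm16_halfEigenCharIdeal_dvd_cyclotomicPrime)
    (hGZ : GrossZagier1986_thm_I_7_3) (hGZK : rank_eq_analyticRank_of_analyticRank_le_one)
    (hmod : hasEntireLFunction_rat) (hmodD : nonempty_modularParametrizationData)
    (hX : ClassX3M W p) (hr : W.analyticRank = 1)
    (hrel : ∀ Dh : PAdicHeightData W p, LeadingTermClauses W p Dh → RelationAt W p Dh)
    {s : ℚ} (hs : shaAn W = (s : ℂ)) (hsv : padicValRat p s = 0) : BSDp W p := by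
  obtain ⟨-, Dh, hB⟩ := hX.delbourgo2002 hDelM
  exact hX.bsdp_rankOne_of_wuthrichHalf_of_censusX42_of_shaAn_unit hW16 hGZ hGZK hmod hmodD hr hB
    (hrel Dh hB) hs hsv

end Summit.BirchSwinnertonDyer.Rank1Residual.AdditivePotMult

namespace Summit.BirchSwinnertonDyer.Rank1Residual.Additive

open CensusX42

variable {W : WeierstrassCurve ℚ} [W.IsElliptic] [W.IsGloballyMinimal] {p : ℕ} [hp : Fact p.Prime]

/-! ### §3 THE census height (gen 2's `RelationAtCensusHeight W p`, scope `p ≥ 5`, `j(E) ∉ {0, 1728}`) -/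

/-- **ONE NODE for THE census height on a unit row**: X4♯(G-ord, `e = 2`) ∩ {`ρ̄` onto}, `p ≥ 5`,
`r_an = 1`, `p ∤ #Ш_an(E)`, Kato's half, GZ, GZK, modularity, a good ORDINARY `V` with `C • V^{(±p)} = W`,
and a height datum `Dh` that IS the twist-transported sigma height of the census
(`IsTwistSigmaHeight W p V Dh`, X42-STEP0 §3–§4) AND carries Delbourgo's (B)-clauses (`hB` — the rmap-2
g9 READING on Gord2, entered as a hypothesis) ⟹ `BSD(E,p)` from `RelationAtCensusHeight W p`
(`relationAt_of_relationAtCensusHeight`, then §1). NO certificate / LOWER / budget / anomalous proviso.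
[cite: MazurSteinTate2006, Thm. 1.3] [cite: Delbourgo2002, Theorem (B) (p. 40)]
[cite: Kato2004Asterisque, Thm. 17.4 (3) (p. 273)] [cite: GrossZagier1986, Thm. I.(7.3)] [cite: Miller2011LMS, Def. 1.1] -/
theorem ClassX4Gord.bsdp_rankOne_of_katoHalf_of_censusX42Height_of_shaAn_unit
    (hK : Wuthrich2014.kato_halfEigenCharIdeal_dvd_cyclotomicPrime_of_surjective)
    (hGZ : GrossZagier1986_thm_I_7_3) (hGZK : rank_eq_analyticRank_of_analyticRank_le_one)
    (hmod : hasEntireLFunction_rat) (hmodD : nonempty_modularParametrizationData)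
    (hX : ClassX4Gord W p) (hp5 : 5 ≤ p) (he : semistabilityIndex W p = 2) (hsurj : Surj W p)
    (hr : W.analyticRank = 1) (hRC : RelationAtCensusHeight W p) (h4 : W.c₄ ≠ 0) (h6 : W.c₆ ≠ 0)
    {V : WeierstrassCurve ℚ} [V.IsElliptic] [V.IsGloballyMinimal] {C : VariableChange ℚ}
    (hord : IsOrdinaryAt V p)
    (hC : C • V.quadraticTwist (p : ℚ) = W ∨ C • V.quadraticTwist (-(p : ℚ)) = W)
    {Dh : PAdicHeightData W p} (hDh : IsTwistSigmaHeight W p V Dh) (hB : LeadingTermClauses W p Dh)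
    {s : ℚ} (hs : shaAn W = (s : ℂ)) (hsv : padicValRat p s = 0) : BSDp W p :=
  hX.bsdp_rankOne_of_katoHalf_of_censusX42_of_shaAn_unit hK hGZ hGZK hmod hmodD he hsurj hr hB
    (relationAt_of_relationAtCensusHeight hRC hp5 h4 h6 hord hC hDh) hs hsv

end Summit.BirchSwinnertonDyer.Rank1Residual.Additive

end
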